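import Literature.NumberTheory.EllipticCurves.NewformsOldNewProofs
import HarnessLib

/-!
# The trivial bound `|a_p| ≤ (p + 1) p^{k/2 - 1}` for the eigenvalues of `T_p` on `S_k(Γ₀(N))`
# (Petersson operator norm; proofs-only companion of `HeckeOperators.lean`, theorems only, D-0026)

Topic `NumberTheory/EllipticCurves`. For a prime `p ∤ N`, every eigenvalue `μ` of the Hecke
operator `T_p = heckeT (Gamma0 N) k p` on `S_k(Γ₀(N))` satisfies

  `|μ|² ≤ (p + 1)² p^{k-2}`   (`norm_sq_eigenvalue_heckeT_gamma0_le`),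

in weight `2`: `|μ| ≤ p + 1` (`norm_eigenvalue_heckeT_gamma0_two_le`). This is the elementary
("trivial", operator-norm) estimate, as opposed to the Ramanujan–Petersson bound
`|μ| ≤ 2 p^{(k-1)/2}` (Deligne; the tree's named fact `Deligne1974_heckeT_eigenvalue_norm_le`); it is
what level-aspect arguments that only need polynomial control of Hecke eigenvalues consume (e.g.
the congruence-splitting proof of Pasten's Thm. 7.5, `PastenValuationProductThm75MultiplicityProofs`,
where it removes Deligne's bound from the inputs).

## The argument (Diamond–Shurman §5.4–5.5, assembled from theorems of the tree)

Let `Γ = Γ₀(N) ≤ SL₂(ℤ)`, `α = diag(1, p)`, `α' = diag(p, 1) = det(α) α⁻¹`,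
`Λ = α⁻¹Γα ∩ Γ`, `Λ' = α'⁻¹Γα' ∩ Γ`, and let `T_p f = μ f`, `f ≠ 0`. In the normalisation of the
tree's `peterssonProduct` (antilinear in the first variable, no volume factor):

1. `conj(μ) P_Γ(f, f) = P_Γ(T_p f, f) = P_Λ(f∣α, f)` — the trace adjunction
   `P_Γ(Tr h, g) = P_{𝒢 ∩ Γ}(h, g)` (`peterssonProduct_trace_left`, Diamond–Shurman Exercise 5.4.4)
   applied to `T_p f = Tr_Γ(f∣α)`;
2. Cauchy–Schwarz for the positive definite Hermitian form `P_Λ` (`norm_sq_peterssonProduct_le`,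
   from `peterssonProduct_self_pos_holds`, sesquilinearity and Hermitian symmetry):
   `|P_Λ(f∣α, f)|² ≤ P_Λ(f∣α, f∣α) · P_Λ(f, f)`;
3. `P_Λ(f, f) = [Γ : Λ] P_Γ(f, f)` (`peterssonProduct_of_le_eq_card_mul`: the trace of `f`, regarded
   at level `Λ`, back to `Γ` is `[Γ : Λ] f`, `trace_eq_card_smul`, and Exercise 5.4.4 again);
4. `P_Λ(f∣α, f∣α) = P_{Λ'}(f∣α∣α', f) = p^{k-2} P_{Λ'}(f, f) = p^{k-2} [Γ : Λ'] P_Γ(f, f)` — the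
   change of variables of Prop. 5.5.2(a) (`peterssonProduct_translate_adjoint`) and
   `f∣αα' = f∣(p·1) = p^{k-2} f` (`slash_scalar_of_pos`; Mathlib's slash action carries `det^{k-1}`);
5. `[Γ : Λ] = [Γ : Λ'] = p + 1`: both are the number of right cosets in
   `Γ₀(N) diag(1,p) Γ₀(N) = Γ₀(N) diag(p,1) Γ₀(N)`, namely the `p + 1` representatives
   `(1 j; 0 p)`, `diag(p, 1)` (`existsUnique_option`, `orbitIndexQuot_bijective` — Lemma 5.1.2 and
   (5.2) — and `tpD_mem_doubleCoset`, proof of Thm. 5.5.3) (`card_quotient_conj_tpG`,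
   `card_quotient_conj_tpD`).

Hence `|μ|² P² ≤ p^{k-2} (p+1) P · (p+1) P` with `P = P_Γ(f, f) > 0`.

## References

* [DiamondShurman2005] F. Diamond, J. Shurman, *A First Course in Modular Forms*, GTM 228: §5.1
  (Lemma 5.1.2, the trace), §5.2 ((5.2), Prop. 5.2.1), §5.4 (Def. 5.4.1 and the remarks after it,
  p. 183; Exercise 5.4.4), §5.5 (Prop. 5.5.2(a), Thm. 5.5.3).
-/

noncomputable section

open scoped MatrixGroups ModularForm ComplexConjugate Modular
open ConjAct Pointwise UpperHalfPlane MeasureTheory ModularGroup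

namespace Literature.NumberTheory.EllipticCurves.ModularForms

/-! ### Cauchy–Schwarz for the Petersson product -/

section CauchySchwarz

variable (Γ : Subgroup (GL (Fin 2) ℝ)) [Γ.IsArithmetic] [Γ.HasDetOne] (k : ℤ)

/-- The Petersson norm `P(f, f)` is the real number `Re P(f, f)` (Hermitian symmetry; this is
`peterssonProduct_self_eq_ofReal` of `PeriodRationalityProofs`, kept private here to avoid that
import). [folklore] -/
private theorem peterssonProduct_self_eq_ofReal_re (f : CuspForm Γ k) :
    peterssonProduct Γ k f f = ((peterssonProduct Γ k f f).re : ℂ) := by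
  have h := peterssonProduct_conj_symm_holds Γ k f f
  exact Complex.ext (by simp) (by simpa using Complex.conj_eq_iff_im.mp h.symm)

/-- `Re P(f, f) ≥ 0` for every cusp form of an arithmetic level `Γ ≤ SL(2, ℝ)` and every weight
(positivity `peterssonProduct_self_pos_holds` for `f ≠ 0`; the special case `Γ₀(N)`, `k = 2` is
`re_peterssonProduct_self_nonneg` of `RankinSymmSquareGL2Bound`). [cite: DiamondShurman2005, §5.4 (after Def. 5.4.1), p. 183] -/
theorem re_peterssonProduct_self_nonneg_level (f : CuspForm Γ k) :
    0 ≤ (peterssonProduct Γ k f f).re := by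
  by_cases hf : f = 0
  · rw [hf, peterssonProduct_zero_left Γ k]
    simp
  · exact (peterssonProduct_self_pos_holds Γ k hf).le

/-- **Cauchy–Schwarz for the Petersson product**: `|P(f, g)|² ≤ P(f, f) · P(g, g)` (the product is
a positive definite Hermitian form, Diamond–Shurman §5.4; expand
`P(a g − b f, a g − b f) ≥ 0` with `a = P(f, f)`, `b = P(f, g)`).
[cite: DiamondShurman2005, §5.4 (after Def. 5.4.1), p. 183] -/
theorem norm_sq_peterssonProduct_le (f g : CuspForm Γ k) :
    ‖peterssonProduct Γ k f g‖ ^ 2 ≤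
      (peterssonProduct Γ k f f).re * (peterssonProduct Γ k g g).re := by
  set a : ℝ := (peterssonProduct Γ k f f).re with ha_def
  set b : ℂ := peterssonProduct Γ k f g with hb_def
  set c : ℝ := (peterssonProduct Γ k g g).re with hc_def
  by_cases hf : f = 0
  · have hb : b = 0 := by rw [hb_def, hf, peterssonProduct_zero_left Γ k]
    have ha : a = 0 := by rw [ha_def, hf, peterssonProduct_zero_left Γ k]; simp
    rw [hb, ha, norm_zero]
    simp
  have ha : 0 < a := peterssonProduct_self_pos_holds Γ k hf
  have hPff : peterssonProduct Γ k f f = (a : ℂ) := peterssonProduct_self_eq_ofReal_re Γ k f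
  have hPgg : peterssonProduct Γ k g g = (c : ℂ) := peterssonProduct_self_eq_ofReal_re Γ k g
  have hPgf : peterssonProduct Γ k g f = conj b := peterssonProduct_conj_symm_holds Γ k f g
  set u : CuspForm Γ k := (a : ℂ) • g + (-b) • f with hu
  have hexp : peterssonProduct Γ k u u = (a : ℂ) * a * c - a * (b * conj b) := by
    simp only [hu, peterssonProduct_add_left, peterssonProduct_add_right, peterssonProduct_smul_left,
      peterssonProduct_smul_right, hPff, hPgg, hPgf, map_neg, Complex.conj_ofReal]
    rw [← hb_def]
    ring
  have hbb : b * conj b = ((‖b‖ ^ 2 : ℝ) : ℂ) := by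
    rw [Complex.mul_conj, Complex.normSq_eq_norm_sq]
  have hre : (peterssonProduct Γ k u u).re = a * a * c - a * ‖b‖ ^ 2 := by
    rw [hexp, hbb]
    simp only [Complex.sub_re, Complex.mul_re, Complex.ofReal_re, Complex.ofReal_im, mul_zero,
      sub_zero]
  have hnn : 0 ≤ (peterssonProduct Γ k u u).re := re_peterssonProduct_self_nonneg_level Γ k u
  rw [hre] at hnn
  have : a * (‖b‖ ^ 2) ≤ a * (a * c) := by nlinarith
  exact le_of_mul_le_mul_left this ha

end CauchySchwarz

/-! ### Restricting the level multiplies the Petersson product by the index -/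

section Restrict

/-- The Petersson product only depends on the level as a subgroup and on the underlying functions
(transport along an equality of levels). [folklore] -/
theorem peterssonProduct_congr_level {Λ₁ Λ₂ : Subgroup (GL (Fin 2) ℝ)} [Λ₁.IsArithmetic]
    [Λ₁.HasDetOne] [Λ₂.IsArithmetic] [Λ₂.HasDetOne] (h : Λ₁ = Λ₂) (k : ℤ)
    (F₁ G₁ : CuspForm Λ₁ k) (F₂ G₂ : CuspForm Λ₂ k) (hF : (⇑F₁ : ℍ → ℂ) = ⇑F₂)
    (hG : (⇑G₁ : ℍ → ℂ) = ⇑G₂) :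
    peterssonProduct Λ₁ k F₁ G₁ = peterssonProduct Λ₂ k F₂ G₂ := by
  subst h
  obtain rfl : F₁ = F₂ := DFunLike.ext' hF
  obtain rfl : G₁ = G₂ := DFunLike.ext' hG
  rfl

/-- The trace to `Γ` of a cusp form of level `Λ ≤ Γ` whose underlying function is a cusp form `f`
of level `Γ` is `[Γ : Λ] • f` (each of the `[Γ : Λ]` summands `f ∣ r⁻¹`, `r ∈ Γ`, is `f`).
[cite: DiamondShurman2005, §5.1 (the trace / Exercise 5.1.4)] -/
theorem trace_eq_card_smul {Γ Λ : Subgroup (GL (Fin 2) ℝ)} [Γ.IsArithmetic] [Γ.HasDetOne]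
    [Λ.IsArithmetic] (k : ℤ) (F : CuspForm Λ k) (f : CuspForm Γ k) (hF : (⇑F : ℍ → ℂ) = ⇑f) :
    CuspForm.trace Γ F = (Nat.card (Γ ⧸ Λ.subgroupOf Γ) : ℂ) • f := by
  letI : Fintype (Γ ⧸ Λ.subgroupOf Γ) := Fintype.ofFinite _
  apply DFunLike.ext
  intro τ
  simp only [CuspForm.coe_trace, Finset.sum_apply, CuspForm.IsGLPos.smul_apply, smul_eq_mul]
  have hq : ∀ q : Γ ⧸ Λ.subgroupOf Γ, SlashInvariantForm.quotientFunc F q τ = f τ := by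
    intro q
    induction q using Quotient.inductionOn with
    | h r =>
      rw [SlashInvariantForm.quotientFunc_mk, hF,
        SlashInvariantFormClass.slash_action_eq f _ (Γ.inv_mem r.2)]
  rw [Finset.sum_congr rfl fun q _ ↦ hq q, Finset.sum_const, Finset.card_univ, nsmul_eq_mul,
    Nat.card_eq_fintype_card]

/-- **Restricting the level multiplies the Petersson product by the index**: for arithmetic
`Λ ≤ Γ ≤ SL₂(ℤ)` and cusp forms `f, g` of level `Γ` regarded as forms `F, G` of level `Λ`,
`P_Λ(F, G) = [Γ : Λ] · P_Γ(f, g)` (Diamond–Shurman Exercise 5.4.4 with the trace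
`Tr_Γ F = [Γ : Λ] f`; in the normalisation of `peterssonProduct`, which has no volume factor).
[cite: DiamondShurman2005, Exercise 5.4.4] -/
theorem peterssonProduct_of_le_eq_card_mul {Γ Λ : Subgroup (GL (Fin 2) ℝ)} [Γ.IsArithmetic]
    [Γ.HasDetOne] [Λ.IsArithmetic] [Λ.HasDetOne] (k : ℤ) (hΛΓ : Λ ≤ Γ) (hΓ : Γ ≤ 𝒮ℒ)
    (F G : CuspForm Λ k) (f g : CuspForm Γ k) (hF : (⇑F : ℍ → ℂ) = ⇑f) (hG : (⇑G : ℍ → ℂ) = ⇑g) :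
    peterssonProduct Λ k F G =
      (Nat.card (Γ ⧸ Λ.subgroupOf Γ) : ℂ) * peterssonProduct Γ k f g := by
  obtain ⟨F₂, hF₂⟩ := exists_cuspForm_coe_eq_of_le (Γ' := Λ ⊓ Γ) inf_le_left F
  obtain ⟨G₂, hG₂⟩ := exists_cuspForm_coe_eq_of_le (Γ' := Λ ⊓ Γ) inf_le_right g
  have h1 : peterssonProduct Γ k (CuspForm.trace Γ F) g = peterssonProduct (Λ ⊓ Γ) k F₂ G₂ :=
    peterssonProduct_trace_left k hΓ F g F₂ G₂ hF₂ hG₂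
  have h2 : peterssonProduct (Λ ⊓ Γ) k F₂ G₂ = peterssonProduct Λ k F G :=
    peterssonProduct_congr_level (inf_of_le_left hΛΓ) k F₂ G₂ F G hF₂ (by rw [hG₂, hG])
  rw [← h2, ← h1, trace_eq_card_smul k F f hF, peterssonProduct_smul_left, Complex.conj_natCast]

end Restrict

/-! ### The index `[Γ₀(N) : Γ₀(N) ∩ α⁻¹ Γ₀(N) α] = p + 1` for `α = diag(1, p)`, `diag(p, 1)` -/

section Index

open CongruenceSubgroup

variable (N : ℕ) (p : ℕ) [NeZero p]

/-- For `p ∤ N` prime, `[Γ₀(N) : Γ₀(N) ∩ diag(1,p)⁻¹ Γ₀(N) diag(1,p)] = p + 1`: the orbit space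
`Γ₀(N) \ Γ₀(N) diag(1,p) Γ₀(N)` has the `p + 1` representatives `(1 j; 0 p)`, `diag(p, 1)`
(Diamond–Shurman (5.2), Lemma 5.1.2). [cite: DiamondShurman2005, Lemma 5.1.2 and (5.2)] -/
theorem card_quotient_conj_tpG (hp : p.Prime) (hpN : ¬ p ∣ N) :
    Nat.card ((Gamma0 N : Subgroup (GL (Fin 2) ℝ)) ⧸
      (toConjAct (tpG p)⁻¹ • (Gamma0 N : Subgroup (GL (Fin 2) ℝ))).subgroupOf
        (Gamma0 N : Subgroup (GL (Fin 2) ℝ))) = p + 1 := by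
  haveI : Fact p.Prime := ⟨hp⟩
  have hbij := orbitIndexQuot_bijective (Γ := (Gamma0 N : Subgroup (GL (Fin 2) ℝ)))
    (Γ' := (Gamma0 N : Subgroup (GL (Fin 2) ℝ))) (G := tpG p)
    (fun i : Option (Fin p) ↦ i.elim (tpD p) fun j ↦ tpB p ((j : ℕ) : ℤ)) (existsUnique_option p N)
    (by rintro (_ | j); exacts [tpD_mem_doubleCoset p N hpN, tpB_mem_doubleCoset p N _])
  rw [Nat.card_eq_of_bijective _ hbij, Nat.card_eq_fintype_card, Fintype.card_option,
    Fintype.card_fin]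

/-- For `p ∤ N` prime, `Γ₀(N) diag(p,1) Γ₀(N) = Γ₀(N) diag(1,p) Γ₀(N)`
(Diamond–Shurman, proof of Thm. 5.5.3). [cite: DiamondShurman2005, proof of Thm. 5.5.3] -/
theorem doubleCoset_tpD_eq (hp : p.Prime) (hpN : ¬ p ∣ N) :
    DoubleCoset.doubleCoset (tpD p)
        (((Gamma0 N : Subgroup SL(2, ℤ)) : Subgroup (GL (Fin 2) ℝ)) : Set (GL (Fin 2) ℝ))
        (((Gamma0 N : Subgroup SL(2, ℤ)) : Subgroup (GL (Fin 2) ℝ)) : Set (GL (Fin 2) ℝ)) =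
      DoubleCoset.doubleCoset (tpG p)
        (((Gamma0 N : Subgroup SL(2, ℤ)) : Subgroup (GL (Fin 2) ℝ)) : Set (GL (Fin 2) ℝ))
        (((Gamma0 N : Subgroup SL(2, ℤ)) : Subgroup (GL (Fin 2) ℝ)) : Set (GL (Fin 2) ℝ)) := by
  haveI : Fact p.Prime := ⟨hp⟩
  exact DoubleCoset.doubleCoset_eq_of_mem (tpD_mem_doubleCoset p N hpN)

/-- For `p ∤ N` prime, `[Γ₀(N) : Γ₀(N) ∩ diag(p,1)⁻¹ Γ₀(N) diag(p,1)] = p + 1` (the double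
cosets of `diag(p, 1)` and `diag(1, p)` coincide). [cite: DiamondShurman2005, Lemma 5.1.2 and proof of Thm. 5.5.3] -/
theorem card_quotient_conj_tpD (hp : p.Prime) (hpN : ¬ p ∣ N) :
    Nat.card ((Gamma0 N : Subgroup (GL (Fin 2) ℝ)) ⧸
      (toConjAct (tpD p)⁻¹ • (Gamma0 N : Subgroup (GL (Fin 2) ℝ))).subgroupOf
        (Gamma0 N : Subgroup (GL (Fin 2) ℝ))) = p + 1 := by
  haveI : Fact p.Prime := ⟨hp⟩
  have hbij := orbitIndexQuot_bijective (Γ := (Gamma0 N : Subgroup (GL (Fin 2) ℝ)))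
    (Γ' := (Gamma0 N : Subgroup (GL (Fin 2) ℝ))) (G := tpD p)
    (fun i : Option (Fin p) ↦ i.elim (tpD p) fun j ↦ tpB p ((j : ℕ) : ℤ))
    (by rw [doubleCoset_tpD_eq N p hp hpN]; exact existsUnique_option p N)
    (by
      rw [doubleCoset_tpD_eq N p hp hpN]
      rintro (_ | j); exacts [tpD_mem_doubleCoset p N hpN, tpB_mem_doubleCoset p N _])
  rw [Nat.card_eq_of_bijective _ hbij, Nat.card_eq_fintype_card, Fintype.card_option,
    Fintype.card_fin]

end Index

/-! ### The trivial bound for the eigenvalues of `T_p` on `S_k(Γ₀(N))` -/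

section EigenvalueBound

open CongruenceSubgroup

variable (N : ℕ) [NeZero N] (k : ℤ) (p : ℕ) [NeZero p]

/-- **The trivial (operator-norm) bound for Hecke eigenvalues**: for `p ∤ N` prime, every
eigenvalue `μ` of `T_p` on `S_k(Γ₀(N))` satisfies `|μ|² ≤ (p + 1)² p^{k-2}`, i.e.
`|μ| ≤ (p + 1) p^{k/2 - 1}` (in weight `2`: `|μ| ≤ p + 1`). Proof (Diamond–Shurman §5.4–5.5): for an
eigenvector `f`, `conj(μ) P(f, f) = P(T_p f, f) = P_Λ(f∣α, f)` with `α = diag(1, p)` and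
`Λ = α⁻¹Γ₀(N)α ∩ Γ₀(N)` (the trace adjunction, Exercise 5.4.4); by Cauchy–Schwarz
`|P_Λ(f∣α, f)|² ≤ P_Λ(f∣α, f∣α) P_Λ(f, f)`, where `P_Λ(f, f) = [Γ₀(N) : Λ] P(f, f) = (p+1) P(f, f)`
and, by the change of variables of Prop. 5.5.2(a), `P_Λ(f∣α, f∣α) = P_{Λ'}(f∣α∣α', f) =
p^{k-2} [Γ₀(N) : Λ'] P(f, f) = p^{k-2} (p + 1) P(f, f)` (`α' = diag(p, 1)`, `αα' = p · 1`,
`Λ' = α'⁻¹Γ₀(N)α' ∩ Γ₀(N)`, both indices being the number `p + 1` of cosets in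
`Γ₀(N) diag(1,p) Γ₀(N) = Γ₀(N) diag(p,1) Γ₀(N)`). This is the elementary substitute for the
Ramanujan–Petersson bound `|μ| ≤ 2 p^{(k-1)/2}` (Deligne). [cite: DiamondShurman2005, Prop. 5.5.2(a), Exercise 5.4.4, Lemma 5.1.2] -/
theorem norm_sq_eigenvalue_heckeT_gamma0_le (hp : p.Prime) (hpN : ¬ p ∣ N) {μ : ℂ}
    (hμ : Module.End.HasEigenvalue (heckeT (Gamma0 N) k p) μ) :
    ‖μ‖ ^ 2 ≤ ((p : ℝ) + 1) ^ 2 * (p : ℝ) ^ (k - 2) := by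
  -- the level, the matrices `α = diag(1,p)`, `α' = diag(p,1)`
  set Γ : Subgroup (GL (Fin 2) ℝ) := ((Gamma0 N : Subgroup SL(2, ℤ)) : Subgroup (GL (Fin 2) ℝ))
    with hΓ_def
  have hΓ : Γ ≤ 𝒮ℒ := Subgroup.map_le_range _ _
  have hp0 : (0 : ℚ) < p := Nat.cast_pos.mpr (NeZero.pos p)
  set α : GL(2, ℚ)⁺ := diagGL 1 p one_pos hp0 with hα_def
  set α' : GL(2, ℚ)⁺ := diagGL p 1 hp0 one_pos with hα'_def
  have hα' : ((α' : GL (Fin 2) ℚ) : Matrix (Fin 2) (Fin 2) ℚ) =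
      ((α : GL (Fin 2) ℚ) : Matrix (Fin 2) (Fin 2) ℚ).adjugate :=
    coe_coe_diagGL_eq_adjugate 1 p one_pos hp0
  -- an eigenvector
  obtain ⟨f, hf⟩ := hμ.exists_hasEigenvector
  have hf0 : f ≠ 0 := hf.2
  have hTf : heckeT Γ k p f = μ • f := hf.apply_eq_smul
  -- the auxiliary levels and forms
  set Λ : Subgroup (GL (Fin 2) ℝ) := toConjAct (glCast (α : GL (Fin 2) ℚ))⁻¹ • Γ ⊓ Γ with hΛ_def
  set Λ' : Subgroup (GL (Fin 2) ℝ) := toConjAct (glCast (α' : GL (Fin 2) ℚ))⁻¹ • Γ ⊓ Γ with hΛ'_def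
  obtain ⟨F₁, hF₁⟩ := exists_cuspForm_coe_eq_of_le (Γ' := Λ) inf_le_left
    (CuspForm.translate f (glCast (α : GL (Fin 2) ℚ)))
  obtain ⟨F, hF⟩ := exists_cuspForm_coe_eq_of_le (Γ' := Λ) inf_le_right f
  obtain ⟨F', hF'⟩ := exists_cuspForm_coe_eq_of_le (Γ' := Λ') inf_le_right f
  -- Step 1: `P(T_p f, f) = P_Λ(f∣α, f)` and `P(T_p f, f) = conj μ · P(f, f)`
  have step1 : peterssonProduct Γ k (heckeT Γ k p f) f = peterssonProduct Λ k F₁ F :=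
    peterssonProduct_trace_left k hΓ (CuspForm.translate f (glCast (α : GL (Fin 2) ℚ))) f F₁ F hF₁ hF
  have hμP : peterssonProduct Γ k (heckeT Γ k p f) f = conj μ * peterssonProduct Γ k f f := by
    rw [hTf, peterssonProduct_smul_left]
  -- Step 2: Cauchy–Schwarz at level `Λ`
  have hCS := norm_sq_peterssonProduct_le Λ k F₁ F
  -- Step 3: `P_Λ(f, f) = (p + 1) P(f, f)`
  have hcardΛ : Nat.card (Γ ⧸ Λ.subgroupOf Γ) = p + 1 := by
    rw [hΛ_def, Subgroup.inf_subgroupOf_right]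
    exact card_quotient_conj_tpG N p hp hpN
  have step3 : peterssonProduct Λ k F F = ((p : ℂ) + 1) * peterssonProduct Γ k f f := by
    rw [peterssonProduct_of_le_eq_card_mul k inf_le_right hΓ F F f f hF hF, hcardΛ]
    push_cast
    ring
  -- Step 4: `P_Λ(f∣α, f∣α) = p^{k-2} P_{Λ'}(f, f) = p^{k-2} (p + 1) P(f, f)`
  have hscalar : (⇑f : ℍ → ℂ) ∣[k] (glCast (α : GL (Fin 2) ℚ) * glCast (α' : GL (Fin 2) ℚ)) =
      ((p : ℂ) ^ (k - 2)) • ⇑f := by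
    rw [glCast_mul_glCast_of_eq_adjugate α α' hα', slash_scalar_of_pos k ⇑f _ (by
      change (0 : ℝ) < ((((α : GL (Fin 2) ℚ) : Matrix (Fin 2) (Fin 2) ℚ).det : ℚ) : ℝ)
      exact_mod_cast α.2)]
    congr 2
    change (((((α : GL (Fin 2) ℚ) : Matrix (Fin 2) (Fin 2) ℚ).det : ℚ) : ℝ) : ℂ) = p
    rw [hα_def, coe_coe_diagGL, Matrix.det_fin_two_of]
    push_cast
    ring
  have hg₁ : (⇑(((p : ℂ) ^ (k - 2)) • F') : ℍ → ℂ) = ⇑F₁ ∣[k] glCast (α' : GL (Fin 2) ℚ) := by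
    rw [CuspForm.IsGLPos.coe_smul, hF', hF₁, coe_cuspForm_translate, ← SlashAction.slash_mul, hscalar]
  have step4a : peterssonProduct Λ k F₁ F₁ = peterssonProduct Λ' k (((p : ℂ) ^ (k - 2)) • F') F' :=
    peterssonProduct_translate_adjoint Λ' (inf_le_right.trans hΓ) k α α' hα' Λ
      (conj_level_adjugate α α' hα' Γ).symm (inf_le_right.trans hΓ) F' F₁ F₁ (((p : ℂ) ^ (k - 2)) • F')
      (by rw [hF₁, hF', coe_cuspForm_translate]) hg₁
  have hcardΛ' : Nat.card (Γ ⧸ Λ'.subgroupOf Γ) = p + 1 := by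
    rw [hΛ'_def, Subgroup.inf_subgroupOf_right]
    exact card_quotient_conj_tpD N p hp hpN
  have step4 : peterssonProduct Λ k F₁ F₁ =
      (p : ℂ) ^ (k - 2) * (((p : ℂ) + 1) * peterssonProduct Γ k f f) := by
    rw [step4a, peterssonProduct_smul_left,
      peterssonProduct_of_le_eq_card_mul k inf_le_right hΓ F' F' f f hF' hF', hcardΛ']
    push_cast
    rw [map_zpow₀, Complex.conj_natCast]
  -- assembly
  set P : ℝ := (peterssonProduct Γ k f f).re with hP_def
  have hP : 0 < P := peterssonProduct_self_pos_holds Γ k hf0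
  have hPeq : peterssonProduct Γ k f f = (P : ℂ) := peterssonProduct_self_eq_ofReal_re Γ k f
  have hpz : (p : ℂ) ^ (k - 2) = (((p : ℝ) ^ (k - 2) : ℝ) : ℂ) := by push_cast; rfl
  have hLHS : ‖peterssonProduct Λ k F₁ F‖ ^ 2 = ‖μ‖ ^ 2 * P ^ 2 := by
    rw [← step1, hμP, hPeq, norm_mul, Complex.norm_conj, Complex.norm_real, Real.norm_eq_abs,
      abs_of_pos hP]
    ring
  have hR1 : (peterssonProduct Λ k F₁ F₁).re = (p : ℝ) ^ (k - 2) * ((p + 1) * P) := by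
    rw [step4, hPeq, hpz]
    norm_cast
  have hR2 : (peterssonProduct Λ k F F).re = (p + 1) * P := by
    rw [step3, hPeq]
    norm_cast
  rw [hLHS, hR1, hR2] at hCS
  have hP2 : 0 < P ^ 2 := by positivity
  have key : ‖μ‖ ^ 2 * P ^ 2 ≤ (((p : ℝ) + 1) ^ 2 * (p : ℝ) ^ (k - 2)) * P ^ 2 := by
    calc ‖μ‖ ^ 2 * P ^ 2 ≤ (p : ℝ) ^ (k - 2) * ((p + 1) * P) * ((p + 1) * P) := hCS
      _ = (((p : ℝ) + 1) ^ 2 * (p : ℝ) ^ (k - 2)) * P ^ 2 := by ring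
  exact le_of_mul_le_mul_right key hP2

/-- **Weight `2`**: every eigenvalue `μ` of `T_p` (`p ∤ N` prime) on `S₂(Γ₀(N))` has `|μ| ≤ p + 1`
(the trivial bound; the Hasse–Weil/Deligne bound is `2√p`). [cite: DiamondShurman2005, Prop. 5.5.2(a), Exercise 5.4.4] -/
theorem norm_eigenvalue_heckeT_gamma0_two_le (hp : p.Prime) (hpN : ¬ p ∣ N) {μ : ℂ}
    (hμ : Module.End.HasEigenvalue (heckeT (Gamma0 N) 2 p) μ) : ‖μ‖ ≤ (p : ℝ) + 1 := by
  have h := norm_sq_eigenvalue_heckeT_gamma0_le N 2 p hp hpN hμ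
  rw [show (2 : ℤ) - 2 = 0 by norm_num, zpow_zero, mul_one] at h
  exact (pow_le_pow_iff_left₀ (norm_nonneg μ) (by positivity) two_ne_zero).1 h

end EigenvalueBound

end Literature.NumberTheory.EllipticCurves.ModularForms

end
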